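import Mathlib
import Summits.AnomalousDissipation.AnomalousDissipation.Theorems.MarginalStabilityChainStretchedVortexRowsStubRowVorticityConstructionToolsGreen
import Summits.AnomalousDissipation.AnomalousDissipation.Theorems.MarginalStabilityChainStretchedVortexRowsStubRowVorticityConstructionToolsReg
import Summits.AnomalousDissipation.AnomalousDissipation.Theorems.MarginalStabilityChainStretchedVortexRowsStubRowVorticityConstructionToolsDiv

/-!
# Stub `stub_rowVorticityConstruction` (crux stmt-AnomalousDissipation-3009) — tools X:
# Green's second identity on the period strip for the regularised cylinder kernel

Helper file (supports stmt-AnomalousDissipation-3009). Third brick of the Poisson equation `ΔΨ = 4πω`: for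
`0 < ε ≤ 1`, `L > 0`, an `L`-periodic `ω ∈ C²` with Gaussian bounds on `ω, Dω, D²ω`, and the smooth kernel
`Φ_ε^L(q) = log(cosh(2πq₂/L) − cos(2πq₁/L) + ε)`,

  `∫_{S_L} Φ_ε^L(q) (Δω)(x − q₁, y − q₂) dq = ∫_{S_L} (ΔΦ_ε^L)(q) ω(x − q₁, y − q₂) dq`,
  `ΔΦ_ε^L(q) = (2π/L)² ε (cosh t + cos s)/(cosh t − cos s + ε)²`, `(s,t) = 2πq/L`

(`green_strip_reg`): the `∂_y²` part is Fubini + the double IBP on lines of tools IX, the `∂ₓ²` part is Fubini +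
the double periodic IBP (boundary terms cancel: `Φ_ε^L, ∂_{q₁}Φ_ε^L, ω, ∂ₓω` are `L`-periodic in `q₁`), and the
two second derivatives of `Φ_ε^L` add up to its Laplacian (tools VIII `lap_logKerReg`). Also here: the physical
(`2π/L`-scaled) derivatives of `Φ_ε^L` and their `ε`-dependent bounds. Registered sub-goal proved here:
`stub_rowVorticityConstruction_greenStripReg`. All `[folklore]`.
-/

set_option linter.dupNamespace false

noncomputable section

open Real Set Filter Topology MeasureTheory
open Literature.Analysis.FluidPDE Literature.Analysis.FluidPDE.StretchedLayer

namespace Summit.AnomalousDissipation.AnomalousDissipation.Theorems.MarginalStabilityChainStretchedVortexRows.RowBiotSavart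

/-! ### Bounds for the regularised kernels at fixed `ε` (normalised variables) -/

section RegBounds

variable {ε : ℝ}

/-- `cosh θ / D_ε ≤ 2 + 2/ε`. [folklore] -/
theorem cosh_div_denReg_le (hε : 0 < ε) (σ θ : ℝ) : Real.cosh θ / (Real.cosh θ - Real.cos σ + ε) ≤ 2 + 2 / ε := by
  have hD := denReg_pos hε σ θ
  have hc := Real.cos_le_one σ
  rw [div_le_iff₀ hD]
  rcases le_or_gt 2 (Real.cosh θ) with h2 | h2
  · have : 0 ≤ 2 / ε * (Real.cosh θ - Real.cos σ + ε) := by positivity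
    nlinarith
  · have h1 : Real.cosh θ ≤ 2 / ε * ε := by rw [div_mul_cancel₀ _ hε.ne']; exact h2.le
    have h3 : 2 / ε * ε ≤ 2 / ε * (Real.cosh θ - Real.cos σ + ε) :=
      mul_le_mul_of_nonneg_left (by linarith [Real.one_le_cosh θ]) (by positivity)
    nlinarith [Real.one_le_cosh θ]

/-- `|sinh θ / D_ε| ≤ 2 + 2/ε`. [folklore] -/
theorem abs_kerRegU_le_const (hε : 0 < ε) (σ θ : ℝ) :
    |Real.sinh θ / (Real.cosh θ - Real.cos σ + ε)| ≤ 2 + 2 / ε := by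
  have hD := denReg_pos hε σ θ
  rw [abs_div, abs_of_pos hD]
  refine le_trans ?_ (cosh_div_denReg_le hε σ θ)
  refine div_le_div_of_nonneg_right ?_ hD.le
  rw [Real.abs_sinh, ← Real.cosh_abs]; exact (Real.sinh_lt_cosh _).le

/-- `|(cosh θ·D_ε − sinh²θ)/D_ε²| ≤ (2 + 2/ε) + (2 + 2/ε)²`. [folklore] -/
theorem abs_kerRegU'_le_const (hε : 0 < ε) (σ θ : ℝ) :
    |(Real.cosh θ * (Real.cosh θ - Real.cos σ + ε) - Real.sinh θ ^ 2) / (Real.cosh θ - Real.cos σ + ε) ^ 2| ≤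
      (2 + 2 / ε) + (2 + 2 / ε) ^ 2 := by
  have hD := denReg_pos hε σ θ
  have h1 := cosh_div_denReg_le hε σ θ
  have h2 := abs_kerRegU_le_const hε σ θ
  have hsplit : (Real.cosh θ * (Real.cosh θ - Real.cos σ + ε) - Real.sinh θ ^ 2) /
      (Real.cosh θ - Real.cos σ + ε) ^ 2 =
      Real.cosh θ / (Real.cosh θ - Real.cos σ + ε) - (Real.sinh θ / (Real.cosh θ - Real.cos σ + ε)) ^ 2 := by
    field_simp
  rw [hsplit]
  refine (abs_sub _ _).trans ?_
  rw [abs_of_nonneg (by positivity : (0:ℝ) ≤ Real.cosh θ / (Real.cosh θ - Real.cos σ + ε)), abs_pow]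
  exact add_le_add h1 (pow_le_pow_left₀ (abs_nonneg _) h2 2)

/-- `|sin σ / D_ε| ≤ 1/ε`. [folklore] -/
theorem abs_kerRegV_le_const (hε : 0 < ε) (σ θ : ℝ) : |Real.sin σ / (Real.cosh θ - Real.cos σ + ε)| ≤ 1 / ε := by
  have hD := denReg_pos hε σ θ
  rw [abs_div, abs_of_pos hD]
  calc |Real.sin σ| / (Real.cosh θ - Real.cos σ + ε) ≤ 1 / (Real.cosh θ - Real.cos σ + ε) :=
        div_le_div_of_nonneg_right (Real.abs_sin_le_one σ) hD.le
    _ ≤ 1 / ε := div_le_div_of_nonneg_left zero_le_one hε (by linarith [den_nonneg σ θ])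

/-- `|(cos σ·D_ε − sin²σ)/D_ε²| ≤ 1/ε + 1/ε²`. [folklore] -/
theorem abs_kerRegV'_le_const (hε : 0 < ε) (σ θ : ℝ) :
    |(Real.cos σ * (Real.cosh θ - Real.cos σ + ε) - Real.sin σ ^ 2) / (Real.cosh θ - Real.cos σ + ε) ^ 2| ≤
      1 / ε + (1 / ε) ^ 2 := by
  have hD := denReg_pos hε σ θ
  have h2 := abs_kerRegV_le_const hε σ θ
  have hsplit : (Real.cos σ * (Real.cosh θ - Real.cos σ + ε) - Real.sin σ ^ 2) / (Real.cosh θ - Real.cos σ + ε) ^ 2 =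
      Real.cos σ / (Real.cosh θ - Real.cos σ + ε) - (Real.sin σ / (Real.cosh θ - Real.cos σ + ε)) ^ 2 := by
    field_simp
  rw [hsplit]
  refine (abs_sub _ _).trans ?_
  rw [abs_pow, abs_div, abs_of_pos hD]
  refine add_le_add ?_ (pow_le_pow_left₀ (abs_nonneg _) h2 2)
  calc |Real.cos σ| / (Real.cosh θ - Real.cos σ + ε) ≤ 1 / (Real.cosh θ - Real.cos σ + ε) :=
        div_le_div_of_nonneg_right (Real.abs_cos_le_one σ) hD.le
    _ ≤ 1 / ε := div_le_div_of_nonneg_left zero_le_one hε (by linarith [den_nonneg σ θ])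

/-- `|Φ_ε| ≤ |log ε| + 2 + |θ|` for `0 < ε ≤ 1` (everywhere, including the origin). [folklore] -/
theorem abs_logKerReg_le_const (hε : 0 < ε) (hε1 : ε ≤ 1) (σ θ : ℝ) :
    |Real.log (Real.cosh θ - Real.cos σ + ε)| ≤ |Real.log ε| + 2 + |θ| := by
  have hup := logKerReg_le hε hε1 σ θ
  have hlow : Real.log ε ≤ Real.log (Real.cosh θ - Real.cos σ + ε) :=
    Real.log_le_log hε (by linarith [den_nonneg σ θ])
  have ha : 0 ≤ |Real.log ε| := abs_nonneg _
  rw [abs_le]; constructor <;> nlinarith [neg_abs_le (Real.log ε), abs_nonneg θ]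

end RegBounds

/-! ### The physical kernel `Φ_ε^L` and its first two derivatives in each variable -/

section Physical

variable {L ε : ℝ}

/-- `∂_{q₂} Φ_ε^L = (2π/L)·sinh/D_ε`. [folklore] -/
theorem hasDerivAt_rowLogKerReg_snd (hε : 0 < ε) (s t : ℝ) :
    HasDerivAt (fun t' => Real.log (Real.cosh (2 * π * t' / L) - Real.cos (2 * π * s / L) + ε))
      (2 * π / L * (Real.sinh (2 * π * t / L) / (Real.cosh (2 * π * t / L) - Real.cos (2 * π * s / L) + ε))) t := by
  have hg : HasDerivAt (fun t' : ℝ => 2 * π * t' / L) (2 * π / L) t := by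
    simpa using ((hasDerivAt_id' t).const_mul (2 * π)).div_const L
  refine (((hg.cosh.sub_const (Real.cos (2 * π * s / L))).add_const ε).log
    (denReg_pos hε _ _).ne').congr_deriv ?_
  ring

/-- `∂_{q₂} ((2π/L) sinh/D_ε) = (2π/L)² (cosh·D_ε − sinh²)/D_ε²`. [folklore] -/
theorem hasDerivAt_rowKerRegU_snd (hε : 0 < ε) (s t : ℝ) :
    HasDerivAt (fun t' => 2 * π / L *
        (Real.sinh (2 * π * t' / L) / (Real.cosh (2 * π * t' / L) - Real.cos (2 * π * s / L) + ε)))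
      ((2 * π / L) ^ 2 * ((Real.cosh (2 * π * t / L) * (Real.cosh (2 * π * t / L) - Real.cos (2 * π * s / L) + ε) -
        Real.sinh (2 * π * t / L) ^ 2) / (Real.cosh (2 * π * t / L) - Real.cos (2 * π * s / L) + ε) ^ 2)) t := by
  have hg : HasDerivAt (fun t' : ℝ => 2 * π * t' / L) (2 * π / L) t := by
    simpa using ((hasDerivAt_id' t).const_mul (2 * π)).div_const L
  have h := ((hasDerivAt_kerRegU_snd hε (2 * π * s / L) (2 * π * t / L)).comp t hg).const_mul (2 * π / L)
  refine h.congr_deriv ?_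
  ring

/-- `∂_{q₁} Φ_ε^L = (2π/L)·sin/D_ε`. [folklore] -/
theorem hasDerivAt_rowLogKerReg_fst (hε : 0 < ε) (s t : ℝ) :
    HasDerivAt (fun s' => Real.log (Real.cosh (2 * π * t / L) - Real.cos (2 * π * s' / L) + ε))
      (2 * π / L * (Real.sin (2 * π * s / L) / (Real.cosh (2 * π * t / L) - Real.cos (2 * π * s / L) + ε))) s := by
  have hg : HasDerivAt (fun s' : ℝ => 2 * π * s' / L) (2 * π / L) s := by
    simpa using ((hasDerivAt_id' s).const_mul (2 * π)).div_const L
  refine (((hg.cos.const_sub (Real.cosh (2 * π * t / L))).add_const ε).log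
    (denReg_pos hε _ _).ne').congr_deriv ?_
  ring

/-- `∂_{q₁} ((2π/L) sin/D_ε) = (2π/L)² (cos·D_ε − sin²)/D_ε²`. [folklore] -/
theorem hasDerivAt_rowKerRegV_fst (hε : 0 < ε) (s t : ℝ) :
    HasDerivAt (fun s' => 2 * π / L *
        (Real.sin (2 * π * s' / L) / (Real.cosh (2 * π * t / L) - Real.cos (2 * π * s' / L) + ε)))
      ((2 * π / L) ^ 2 * ((Real.cos (2 * π * s / L) * (Real.cosh (2 * π * t / L) - Real.cos (2 * π * s / L) + ε) -
        Real.sin (2 * π * s / L) ^ 2) / (Real.cosh (2 * π * t / L) - Real.cos (2 * π * s / L) + ε) ^ 2)) s := by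
  have hg : HasDerivAt (fun s' : ℝ => 2 * π * s' / L) (2 * π / L) s := by
    simpa using ((hasDerivAt_id' s).const_mul (2 * π)).div_const L
  have h := ((hasDerivAt_kerRegV_fst hε (2 * π * s / L) (2 * π * t / L)).comp s hg).const_mul (2 * π / L)
  refine h.congr_deriv ?_
  ring

/-- `∂ₓ` of an `L`-periodic field is `L`-periodic (no differentiability needed). [folklore] -/
theorem dX_add_period {ω : ℝ → ℝ → ℝ} (hper : ∀ x y, ω (x + L) y = ω x y) (a b : ℝ) : dX ω (a + L) b = dX ω a b := by
  simp only [dX]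
  rw [← deriv_comp_add_const (fun s => ω s b) L a]
  simp only [hper]

end Physical

/-! ### Green's second identity on the strip for `Φ_ε^L` -/

section Green

variable {L ε : ℝ} {ω : ℝ → ℝ → ℝ}

/-- **The `∂_y²` part**: `∫_{S_L} Φ_ε^L (∂_y²ω)(p − q) dq = ∫_{S_L} (∂_{q₂}²Φ_ε^L) ω(p − q) dq`. [folklore] -/
theorem green_strip_reg_snd (hL : 0 < L) (hε : 0 < ε) (hε1 : ε ≤ 1) (hω : ContDiff ℝ 2 fun p : ℝ × ℝ => ω p.1 p.2)
    (hB : ∀ i ≤ 2, ∃ C a : ℝ, 0 < a ∧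
      ∀ p, ‖iteratedFDeriv ℝ i (fun p : ℝ × ℝ => ω p.1 p.2) p‖ ≤ C * Real.exp (-a * p.2 ^ 2)) (x y : ℝ) :
    ∫ q in Ioc (-(L / 2)) (L / 2) ×ˢ (univ : Set ℝ),
        Real.log (Real.cosh (2 * π * q.2 / L) - Real.cos (2 * π * q.1 / L) + ε) * dY (dY ω) (x - q.1) (y - q.2) =
      ∫ q in Ioc (-(L / 2)) (L / 2) ×ˢ (univ : Set ℝ),
        (2 * π / L) ^ 2 * ((Real.cosh (2 * π * q.2 / L) * (Real.cosh (2 * π * q.2 / L) - Real.cos (2 * π * q.1 / L) + ε) -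
          Real.sinh (2 * π * q.2 / L) ^ 2) / (Real.cosh (2 * π * q.2 / L) - Real.cos (2 * π * q.1 / L) + ε) ^ 2) *
          ω (x - q.1) (y - q.2) := by
  have hω1 : ContDiff ℝ 1 fun p : ℝ × ℝ => ω p.1 p.2 := hω.of_le one_le_two
  obtain ⟨⟨C, a, ha, hb⟩, ⟨C', a', ha', hb'⟩⟩ := gaussBounds_of_iterated (ω := ω) fun i hi => hB i (hi.trans one_le_two)
  obtain ⟨C₂, a₂, ha₂, hb₂⟩ := hB 2 le_rfl
  set S : Set (ℝ × ℝ) := Ioc (-(L / 2)) (L / 2) ×ˢ (univ : Set ℝ)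
  -- integrability of both sides on the strip
  have mΦ : Measurable fun q : ℝ × ℝ => Real.log (Real.cosh (2 * π * q.2 / L) - Real.cos (2 * π * q.1 / L) + ε) := by
    fun_prop
  have mU : Measurable fun q : ℝ × ℝ =>
      (2 * π / L) ^ 2 * ((Real.cosh (2 * π * q.2 / L) * (Real.cosh (2 * π * q.2 / L) - Real.cos (2 * π * q.1 / L) + ε) -
        Real.sinh (2 * π * q.2 / L) ^ 2) / (Real.cosh (2 * π * q.2 / L) - Real.cos (2 * π * q.1 / L) + ε) ^ 2) := by
    fun_prop
  have gtΦ : ∀ c : ℝ, 0 < c → ∀ y₀ : ℝ, Integrable (fun q : ℝ × ℝ =>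
      ‖Real.log (Real.cosh (2 * π * q.2 / L) - Real.cos (2 * π * q.1 / L) + ε)‖ * Real.exp (-c * (y₀ - q.2) ^ 2))
      (volume.restrict S) := by
    refine gaussTestable_of_le mΦ (A := |Real.log ε| + 2) (B := 2 * π / L) (D := 0) (by positivity) le_rfl
      fun q _ => ?_
    have h := abs_logKerReg_le_const hε hε1 (2 * π * q.1 / L) (2 * π * q.2 / L)
    have habs : |2 * π * q.2 / L| = 2 * π / L * |q.2| := by
      rw [abs_div, abs_mul, abs_of_pos hL, abs_of_pos (by positivity : (0:ℝ) < 2 * π)]; ring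
    rw [habs] at h; simpa using h
  have gtU : ∀ c : ℝ, 0 < c → ∀ y₀ : ℝ, Integrable (fun q : ℝ × ℝ =>
      ‖(2 * π / L) ^ 2 * ((Real.cosh (2 * π * q.2 / L) * (Real.cosh (2 * π * q.2 / L) - Real.cos (2 * π * q.1 / L) + ε) -
          Real.sinh (2 * π * q.2 / L) ^ 2) / (Real.cosh (2 * π * q.2 / L) - Real.cos (2 * π * q.1 / L) + ε) ^ 2)‖ *
        Real.exp (-c * (y₀ - q.2) ^ 2)) (volume.restrict S) := by
    refine gaussTestable_of_le mU (A := (2 * π / L) ^ 2 * ((2 + 2 / ε) + (2 + 2 / ε) ^ 2)) (B := 0) (D := 0)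
      le_rfl le_rfl fun q _ => ?_
    have h := abs_kerRegU'_le_const hε (2 * π * q.1 / L) (2 * π * q.2 / L)
    rw [abs_mul, abs_of_pos (by positivity : (0:ℝ) < (2 * π / L) ^ 2)]
    simpa using mul_le_mul_of_nonneg_left h (by positivity : (0:ℝ) ≤ (2 * π / L) ^ 2)
  have cYY : Continuous fun p : ℝ × ℝ => dY (dY ω) p.1 p.2 := continuous_dY (contDiff_one_dY hω)
  have bYY : ∀ p : ℝ × ℝ, ‖(fun p : ℝ × ℝ => dY (dY ω) p.1 p.2) p‖ ≤ C₂ * Real.exp (-a₂ * p.2 ^ 2) := fun p => by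
    rw [Real.norm_eq_abs]; exact abs_dY_dY_le hω hb₂ p.1 p.2
  have bF : ∀ p : ℝ × ℝ, ‖(fun p : ℝ × ℝ => ω p.1 p.2) p‖ ≤ C * Real.exp (-a * p.2 ^ 2) := fun p => by
    rw [Real.norm_eq_abs]; exact hb p.1 p.2
  have iL : Integrable (fun q : ℝ × ℝ =>
      Real.log (Real.cosh (2 * π * q.2 / L) - Real.cos (2 * π * q.1 / L) + ε) * dY (dY ω) (x - q.1) (y - q.2))
      (volume.restrict S) := by
    have := integrable_ker_smul mΦ.aestronglyMeasurable gtΦ cYY ha₂ bYY (x, y)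
    simpa only [smul_eq_mul, Prod.fst_sub, Prod.snd_sub] using this
  have iR : Integrable (fun q : ℝ × ℝ =>
      (2 * π / L) ^ 2 * ((Real.cosh (2 * π * q.2 / L) * (Real.cosh (2 * π * q.2 / L) - Real.cos (2 * π * q.1 / L) + ε) -
          Real.sinh (2 * π * q.2 / L) ^ 2) / (Real.cosh (2 * π * q.2 / L) - Real.cos (2 * π * q.1 / L) + ε) ^ 2) *
        ω (x - q.1) (y - q.2)) (volume.restrict S) := by
    have := integrable_ker_smul mU.aestronglyMeasurable gtU hω.continuous ha bF (x, y)
    simpa only [smul_eq_mul, Prod.fst_sub, Prod.snd_sub] using this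
  rw [volume_restrict_strip] at iL iR ⊢
  rw [integral_prod _ iL, integral_prod _ iR]
  refine integral_congr_ae (Eventually.of_forall fun q₁ => ?_)
  -- the line `{q₁} × ℝ`: double IBP
  have habs : ∀ t : ℝ, |2 * π * t / L| = 2 * π / L * |t| := fun t => by
    rw [abs_div, abs_mul, abs_of_pos hL, abs_of_pos (by positivity : (0:ℝ) < 2 * π)]; ring
  have mU'' : AEStronglyMeasurable (fun t : ℝ => (2 * π / L) ^ 2 *
      ((Real.cosh (2 * π * t / L) * (Real.cosh (2 * π * t / L) - Real.cos (2 * π * q₁ / L) + ε) -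
        Real.sinh (2 * π * t / L) ^ 2) / (Real.cosh (2 * π * t / L) - Real.cos (2 * π * q₁ / L) + ε) ^ 2)) := by
    have : Measurable (fun t : ℝ => (2 * π / L) ^ 2 *
      ((Real.cosh (2 * π * t / L) * (Real.cosh (2 * π * t / L) - Real.cos (2 * π * q₁ / L) + ε) -
        Real.sinh (2 * π * t / L) ^ 2) / (Real.cosh (2 * π * t / L) - Real.cos (2 * π * q₁ / L) + ε) ^ 2)) := by
      fun_prop
    exact this.aestronglyMeasurable
  have hline : Continuous fun t : ℝ => ((x - q₁, y - t) : ℝ × ℝ) :=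
    continuous_const.prodMk (continuous_const.sub continuous_id)
  have mg'' : AEStronglyMeasurable (fun t : ℝ => dY (dY ω) (x - q₁) (y - t)) := (cYY.comp hline).aestronglyMeasurable
  show (∫ t, Real.log (Real.cosh (2 * π * t / L) - Real.cos (2 * π * q₁ / L) + ε) * dY (dY ω) (x - q₁) (y - t)) =
    ∫ t, (2 * π / L) ^ 2 * ((Real.cosh (2 * π * t / L) * (Real.cosh (2 * π * t / L) - Real.cos (2 * π * q₁ / L) + ε) -
      Real.sinh (2 * π * t / L) ^ 2) / (Real.cosh (2 * π * t / L) - Real.cos (2 * π * q₁ / L) + ε) ^ 2) * ω (x - q₁) (y - t)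
  refine integral_mul_deriv2_eq_line (fun t => hasDerivAt_rowLogKerReg_snd hε q₁ t)
    (fun t => hasDerivAt_rowKerRegU_snd hε q₁ t)
    (fun t => HasDerivAt.comp_const_sub y t (hasDerivAt_slice_snd hω1 (x - q₁) (y - t)))
    (fun t => hasDerivAt_dY_slice hω (x - q₁) y t) mU'' mg''
    ha ha' ha₂ (A := |Real.log ε| + 2) (B := 2 * π / L) (K₁ := 2 * π / L * (2 + 2 / ε))
    (K₂ := (2 * π / L) ^ 2 * ((2 + 2 / ε) + (2 + 2 / ε) ^ 2)) (C₀ := C) (C₁ := C') (C₂ := C₂) (y := y)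
    (fun t => ?_) (fun t => ?_) (fun t => ?_) (fun t => hb _ _) (fun t => ?_) (fun t => abs_dY_dY_le hω hb₂ _ _)
  · have h := abs_logKerReg_le_const hε hε1 (2 * π * q₁ / L) (2 * π * t / L)
    rw [habs] at h; linarith
  · rw [abs_mul, abs_of_pos (by positivity : (0:ℝ) < 2 * π / L)]
    exact mul_le_mul_of_nonneg_left (abs_kerRegU_le_const hε _ _) (by positivity)
  · rw [abs_mul, abs_of_pos (by positivity : (0:ℝ) < (2 * π / L) ^ 2)]
    exact mul_le_mul_of_nonneg_left (abs_kerRegU'_le_const hε _ _) (by positivity)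
  · rw [abs_neg]; exact abs_dY_le hω1 hb' _ _

/-- **The `∂ₓ²` part**: `∫_{S_L} Φ_ε^L (∂ₓ²ω)(p − q) dq = ∫_{S_L} (∂_{q₁}²Φ_ε^L) ω(p − q) dq` (periodic in `q₁`).
[folklore] -/
theorem green_strip_reg_fst (hL : 0 < L) (hε : 0 < ε) (hε1 : ε ≤ 1) (hω : ContDiff ℝ 2 fun p : ℝ × ℝ => ω p.1 p.2)
    (hB : ∀ i ≤ 2, ∃ C a : ℝ, 0 < a ∧
      ∀ p, ‖iteratedFDeriv ℝ i (fun p : ℝ × ℝ => ω p.1 p.2) p‖ ≤ C * Real.exp (-a * p.2 ^ 2))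
    (hper : ∀ x y, ω (x + L) y = ω x y) (x y : ℝ) :
    ∫ q in Ioc (-(L / 2)) (L / 2) ×ˢ (univ : Set ℝ),
        Real.log (Real.cosh (2 * π * q.2 / L) - Real.cos (2 * π * q.1 / L) + ε) * dX (dX ω) (x - q.1) (y - q.2) =
      ∫ q in Ioc (-(L / 2)) (L / 2) ×ˢ (univ : Set ℝ),
        (2 * π / L) ^ 2 * ((Real.cos (2 * π * q.1 / L) * (Real.cosh (2 * π * q.2 / L) - Real.cos (2 * π * q.1 / L) + ε) -
          Real.sin (2 * π * q.1 / L) ^ 2) / (Real.cosh (2 * π * q.2 / L) - Real.cos (2 * π * q.1 / L) + ε) ^ 2) *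
          ω (x - q.1) (y - q.2) := by
  have hω1 : ContDiff ℝ 1 fun p : ℝ × ℝ => ω p.1 p.2 := hω.of_le one_le_two
  obtain ⟨⟨C, a, ha, hb⟩, -⟩ := gaussBounds_of_iterated (ω := ω) fun i hi => hB i (hi.trans one_le_two)
  obtain ⟨C₂, a₂, ha₂, hb₂⟩ := hB 2 le_rfl
  set S : Set (ℝ × ℝ) := Ioc (-(L / 2)) (L / 2) ×ˢ (univ : Set ℝ)
  have mΦ : Measurable fun q : ℝ × ℝ => Real.log (Real.cosh (2 * π * q.2 / L) - Real.cos (2 * π * q.1 / L) + ε) := by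
    fun_prop
  have mV : Measurable fun q : ℝ × ℝ =>
      (2 * π / L) ^ 2 * ((Real.cos (2 * π * q.1 / L) * (Real.cosh (2 * π * q.2 / L) - Real.cos (2 * π * q.1 / L) + ε) -
        Real.sin (2 * π * q.1 / L) ^ 2) / (Real.cosh (2 * π * q.2 / L) - Real.cos (2 * π * q.1 / L) + ε) ^ 2) := by
    fun_prop
  have gtΦ : ∀ c : ℝ, 0 < c → ∀ y₀ : ℝ, Integrable (fun q : ℝ × ℝ =>
      ‖Real.log (Real.cosh (2 * π * q.2 / L) - Real.cos (2 * π * q.1 / L) + ε)‖ * Real.exp (-c * (y₀ - q.2) ^ 2))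
      (volume.restrict S) := by
    refine gaussTestable_of_le mΦ (A := |Real.log ε| + 2) (B := 2 * π / L) (D := 0) (by positivity) le_rfl
      fun q _ => ?_
    have h := abs_logKerReg_le_const hε hε1 (2 * π * q.1 / L) (2 * π * q.2 / L)
    have habs : |2 * π * q.2 / L| = 2 * π / L * |q.2| := by
      rw [abs_div, abs_mul, abs_of_pos hL, abs_of_pos (by positivity : (0:ℝ) < 2 * π)]; ring
    rw [habs] at h; simpa using h
  have gtV : ∀ c : ℝ, 0 < c → ∀ y₀ : ℝ, Integrable (fun q : ℝ × ℝ =>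
      ‖(2 * π / L) ^ 2 * ((Real.cos (2 * π * q.1 / L) * (Real.cosh (2 * π * q.2 / L) - Real.cos (2 * π * q.1 / L) + ε) -
          Real.sin (2 * π * q.1 / L) ^ 2) / (Real.cosh (2 * π * q.2 / L) - Real.cos (2 * π * q.1 / L) + ε) ^ 2)‖ *
        Real.exp (-c * (y₀ - q.2) ^ 2)) (volume.restrict S) := by
    refine gaussTestable_of_le mV (A := (2 * π / L) ^ 2 * (1 / ε + (1 / ε) ^ 2)) (B := 0) (D := 0)
      le_rfl le_rfl fun q _ => ?_
    have h := abs_kerRegV'_le_const hε (2 * π * q.1 / L) (2 * π * q.2 / L)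
    rw [abs_mul, abs_of_pos (by positivity : (0:ℝ) < (2 * π / L) ^ 2)]
    simpa using mul_le_mul_of_nonneg_left h (by positivity : (0:ℝ) ≤ (2 * π / L) ^ 2)
  have cXX : Continuous fun p : ℝ × ℝ => dX (dX ω) p.1 p.2 := continuous_dX (contDiff_one_dX hω)
  have bXX : ∀ p : ℝ × ℝ, ‖(fun p : ℝ × ℝ => dX (dX ω) p.1 p.2) p‖ ≤ C₂ * Real.exp (-a₂ * p.2 ^ 2) := fun p => by
    rw [Real.norm_eq_abs]; exact abs_dX_dX_le hω hb₂ p.1 p.2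
  have bF : ∀ p : ℝ × ℝ, ‖(fun p : ℝ × ℝ => ω p.1 p.2) p‖ ≤ C * Real.exp (-a * p.2 ^ 2) := fun p => by
    rw [Real.norm_eq_abs]; exact hb p.1 p.2
  have iL : Integrable (fun q : ℝ × ℝ =>
      Real.log (Real.cosh (2 * π * q.2 / L) - Real.cos (2 * π * q.1 / L) + ε) * dX (dX ω) (x - q.1) (y - q.2))
      (volume.restrict S) := by
    have := integrable_ker_smul mΦ.aestronglyMeasurable gtΦ cXX ha₂ bXX (x, y)
    simpa only [smul_eq_mul, Prod.fst_sub, Prod.snd_sub] using this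
  have iR : Integrable (fun q : ℝ × ℝ =>
      (2 * π / L) ^ 2 * ((Real.cos (2 * π * q.1 / L) * (Real.cosh (2 * π * q.2 / L) - Real.cos (2 * π * q.1 / L) + ε) -
          Real.sin (2 * π * q.1 / L) ^ 2) / (Real.cosh (2 * π * q.2 / L) - Real.cos (2 * π * q.1 / L) + ε) ^ 2) *
        ω (x - q.1) (y - q.2)) (volume.restrict S) := by
    have := integrable_ker_smul mV.aestronglyMeasurable gtV hω.continuous ha bF (x, y)
    simpa only [smul_eq_mul, Prod.fst_sub, Prod.snd_sub] using this
  rw [volume_restrict_strip] at iL iR ⊢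
  rw [integral_prod_symm _ iL, integral_prod_symm _ iR]
  refine integral_congr_ae (Eventually.of_forall fun t => ?_)
  -- the period `(−L/2, L/2] × {t}`: double periodic IBP
  have hle : -(L / 2) ≤ L / 2 := by linarith
  have hD : ∀ s, 0 < Real.cosh (2 * π * t / L) - Real.cos (2 * π * s / L) + ε := fun s => denReg_pos hε _ _
  show (∫ s in Ioc (-(L / 2)) (L / 2), Real.log (Real.cosh (2 * π * t / L) - Real.cos (2 * π * s / L) + ε) *
      dX (dX ω) (x - s) (y - t)) = ∫ s in Ioc (-(L / 2)) (L / 2),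
      (2 * π / L) ^ 2 * ((Real.cos (2 * π * s / L) * (Real.cosh (2 * π * t / L) - Real.cos (2 * π * s / L) + ε) -
        Real.sin (2 * π * s / L) ^ 2) / (Real.cosh (2 * π * t / L) - Real.cos (2 * π * s / L) + ε) ^ 2) * ω (x - s) (y - t)
  rw [← intervalIntegral.integral_of_le hle, ← intervalIntegral.integral_of_le hle]
  have hπL : 2 * π * (L / 2) / L = π := by field_simp
  refine intervalIntegral_mul_deriv2_eq_periodic (fun s => hasDerivAt_rowLogKerReg_fst hε s t)
    (fun s => hasDerivAt_rowKerRegV_fst hε s t)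
    (fun s => HasDerivAt.comp_const_sub x s (hasDerivAt_slice_fst hω1 (x - s) (y - t)))
    (fun s => hasDerivAt_dX_slice hω x (y - t) s) ?_
    (cXX.comp ((continuous_const.sub continuous_id).prodMk continuous_const)) ?_ ?_ ?_ ?_
  · exact continuous_const.mul (Continuous.div (by fun_prop) (by fun_prop) fun s => (pow_pos (hD s) 2).ne')
  · rw [show 2 * π * -(L / 2) / L = -(2 * π * (L / 2) / L) by ring, Real.cos_neg]
  · rw [show 2 * π * -(L / 2) / L = -(2 * π * (L / 2) / L) by ring, Real.cos_neg, Real.sin_neg, hπL, Real.sin_pi]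
    simp
  · rw [show x - -(L / 2) = x - L / 2 + L by ring, hper]
  · rw [show x - -(L / 2) = x - L / 2 + L by ring, dX_add_period hper]

end Green

end RowBiotSavart

open RowBiotSavart in
/-- **Green's identity on the strip, `∂_y²` part** (registered on stmt-AnomalousDissipation-3009 as the helper stub
`stub_rowVorticityConstruction_greenStripReg` of `stub_rowVorticityConstruction`): for `0 < ε ≤ 1`, `L > 0` and
`ω ∈ C²` with Gaussian bounds on `ω, Dω, D²ω`,
`∫_{S_L} Φ_ε^L(q) (∂_y²ω)(x − q₁, y − q₂) dq = ∫_{S_L} (∂_{q₂}²Φ_ε^L)(q) ω(x − q₁, y − q₂) dq`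
(`RowBiotSavart.green_strip_reg_snd`; the `∂ₓ²` part is `green_strip_reg_fst`). [folklore] -/
theorem stub_rowVorticityConstruction_greenStripReg :
    ∀ (L ε : ℝ) (ω : ℝ → ℝ → ℝ), 0 < L → 0 < ε → ε ≤ 1 → ContDiff ℝ 2 (fun p : ℝ × ℝ => ω p.1 p.2) →
      (∀ i ≤ 2, ∃ C a : ℝ, 0 < a ∧
        ∀ p : ℝ × ℝ, ‖iteratedFDeriv ℝ i (fun p : ℝ × ℝ => ω p.1 p.2) p‖ ≤ C * Real.exp (-a * p.2 ^ 2)) →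
      ∀ x y : ℝ,
        ∫ q in Set.Ioc (-(L / 2)) (L / 2) ×ˢ (Set.univ : Set ℝ),
            Real.log (Real.cosh (2 * Real.pi * q.2 / L) - Real.cos (2 * Real.pi * q.1 / L) + ε) *
              dY (dY ω) (x - q.1) (y - q.2) =
          ∫ q in Set.Ioc (-(L / 2)) (L / 2) ×ˢ (Set.univ : Set ℝ),
            (2 * Real.pi / L) ^ 2 * ((Real.cosh (2 * Real.pi * q.2 / L) *
              (Real.cosh (2 * Real.pi * q.2 / L) - Real.cos (2 * Real.pi * q.1 / L) + ε) -
                Real.sinh (2 * Real.pi * q.2 / L) ^ 2) /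
              (Real.cosh (2 * Real.pi * q.2 / L) - Real.cos (2 * Real.pi * q.1 / L) + ε) ^ 2) * ω (x - q.1) (y - q.2) :=
  fun _ _ _ hL hε hε1 hω hB x y => green_strip_reg_snd hL hε hε1 hω hB x y

end Summit.AnomalousDissipation.AnomalousDissipation.Theorems.MarginalStabilityChainStretchedVortexRows

end
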